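import Mathlib
import HarnessLib
import Literature.Probability.RandomPlanarGeometry.NestingTransform
import Literature.Probability.Percolation.NestingPhaseEstimates
import Literature.Probability.Percolation.NestingWeightMeasurable
import Literature.Probability.Percolation.SiteNestingWeightBound
import Summits.CriticalPhenomena.CardyFormulaZ2.Theorems.CardyMagicRigidityMagicFormulaTStubUVSandwich

/-!
# Line `Sketch` (v10) for crux `MagicFormulaT`, sub-goal CR `cr_expect_powerSums_eq_counts`:
# the count representation of the two-point power-sum statistics at fixed mesh

Crux `Summit.CriticalPhenomena.CardyFormulaZ2.Theses.CardyMagicRigidity.MagicFormulaT`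
(stmt-CriticalPhenomena-4836), line `Sketch`, skeleton v10, registered sub-goal
`cr_expect_powerSums_eq_counts` (wave 4).  With `θ_u = u.nestingPhase f = ∫_{W(u,·) ≠ 0} f` over
the interface loops `u` of `siteLoopConfig δ ω` under `triSitePercolation half`, the order-2
statistics of the line are `A₂ = Σ_u θ_u²` and `A₁² = (Σ_u θ_u)²`; the literature speaks about
COUNTS of loops surrounding points.  This file proves the exact bridge at fixed mesh `δ > 0`, for an
admissible density `f` (measurable, `|f| ≤ C`, `f = 0` off `B̄(0, R)`, `∫ f = 0`):

`E[A₂] = ∬ f(x) f(y) E[N(x ∧ y)] dx dy`, `E[A₁²] = ∬ f(x) f(y) E[N(x) N(y)] dx dy`,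

where `N(x) = #{u : W(u, x) ≠ 0, u meets B̄(0, R)}` and
`N(x ∧ y) = #{u : W(u, x) ≠ 0, W(u, y) ≠ 0, u meets B̄(0, R)}`.

* §1 finitary bookkeeping (`cr_sum_eq_card_mul`, `cr_ncard_sep_eq_card_filter`);
* §2 measurability of the cardinality of a finite random sub-family of a countable family
  (`cr_measurable_ncard`: the fibre over `n` is a countable union of countable intersections of
  membership events) and its instance for the interface loops meeting a ball
  (`cr_measurable_ncard_loops`: lattice polygons form a countable family,
  `loops_siteLoopConfig_subset_range`, membership is measurable,
  `measurable_mem_loops_siteLoopConfig`, finitely many loops meet the ball,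
  `ncard_loops_siteLoopConfig_meeting_le`);
* §3 the PATHWISE identities (`cr_pathwise`): only the finitely many loops meeting `B̄(0, R)`
  contribute (`sw_meets_of_nestingPhase_ne_zero`), `θ_u = ∫ f 𝟙_{W(u,·) ≠ 0}`, products of
  integrals are iterated integrals and finite sums commute with integrals, so
  `A₂ = ∬ f f N_ω(x ∧ y)` and `A₁² = ∬ f f N_ω(x) N_ω(y)`;
* §4 Fubini (`cr_integral_integral_integral_swap`): the counts are bounded by the deterministic
  number of faces near the ball and jointly measurable, so the expectation passes inside.

Everything is proved from tree / Mathlib material; no named fact is used; no definition is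
introduced.
-/

noncomputable section

namespace Summit.CriticalPhenomena.CardyFormulaZ2.Cruxes.MagicFormulaT.LineSketch

open MeasureTheory Filter Set Metric
open scoped Real Topology BigOperators ENNReal
open Literature.Probability.RandomPlanarGeometry Literature.Probability.Percolation
  Literature.Probability.LatticeModels

/-! ## §1 Finitary bookkeeping -/

/-- A finite sum whose terms equal the constant `c` where `p` holds and vanish elsewhere is
`#{p} · c`. -/
theorem cr_sum_eq_card_mul {ι : Type*} (S : Finset ι) (p : ι → Prop) [DecidablePred p]
    (G : ι → ℝ) (c : ℝ) (h1 : ∀ u ∈ S, p u → G u = c) (h2 : ∀ u ∈ S, ¬p u → G u = 0) :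
    ∑ u ∈ S, G u = (S.filter p).card * c := by
  rw [← Finset.sum_filter_add_sum_filter_not S p G,
    Finset.sum_congr rfl fun u hu ↦ h1 u (Finset.mem_filter.1 hu).1 (Finset.mem_filter.1 hu).2,
    Finset.sum_eq_zero fun u hu ↦ h2 u (Finset.mem_filter.1 hu).1 (Finset.mem_filter.1 hu).2,
    add_zero, Finset.sum_const, nsmul_eq_mul]

/-- The members of `L` satisfying `q ↔ p ∧ M` are counted by filtering by `p` the finite family
`S` of the members of `L` satisfying `M`. -/
theorem cr_ncard_sep_eq_card_filter {ι : Type*} {L : Set ι} {M : ι → Prop} {S : Finset ι}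
    (hS : ∀ u, u ∈ S ↔ u ∈ L ∧ M u) (q p : ι → Prop) [DecidablePred p]
    (hq : ∀ u, q u ↔ p u ∧ M u) : {u ∈ L | q u}.ncard = (S.filter p).card := by
  rw [← Set.ncard_coe_finset]
  congr 1
  ext u
  simp only [Finset.coe_filter, Set.mem_setOf_eq, hS, hq]
  tauto

/-! ## §2 Measurability of the cardinality of a finite random sub-family of a countable family -/

/-- **Counting measurably.**  If a random set `A b` is always a finite subset of a fixed countable
set `𝓡` and every membership event `{b | a ∈ A b}` is measurable, then `b ↦ #(A b)` is
measurable: the fibre over `n` is the countable union, over the finite `t ⊆ 𝓡` with `#t = n`, of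
the events `{A = t} = ⋂_{a ∈ 𝓡} {a ∈ A ↔ a ∈ t}`. -/
theorem cr_measurable_ncard {α β : Type*} [MeasurableSpace β] {𝓡 : Set α} (h𝓡 : 𝓡.Countable)
    {A : β → Set α} (hA𝓡 : ∀ b, A b ⊆ 𝓡) (hAfin : ∀ b, (A b).Finite)
    (hmeas : ∀ a, Measurable fun b ↦ a ∈ A b) : Measurable fun b ↦ (A b).ncard := by
  refine measurable_to_countable' fun n ↦ ?_
  have hD : {t : Set α | t.Finite ∧ t ⊆ 𝓡 ∧ t.ncard = n}.Countable :=
    Set.Countable.mono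
      (fun t (ht : t.Finite ∧ t ⊆ 𝓡 ∧ t.ncard = n) ↦ show t.Finite ∧ t ⊆ 𝓡 from ⟨ht.1, ht.2.1⟩)
      (Set.countable_setOf_finite_subset h𝓡)
  have heq : (fun b ↦ (A b).ncard) ⁻¹' {n} =
      ⋃ t ∈ {t : Set α | t.Finite ∧ t ⊆ 𝓡 ∧ t.ncard = n}, ⋂ a ∈ 𝓡, {b | a ∈ A b ↔ a ∈ t} := by
    ext b
    rw [Set.mem_preimage, Set.mem_singleton_iff, Set.mem_iUnion₂]
    constructor
    · intro hb
      refine ⟨A b, show (A b).Finite ∧ A b ⊆ 𝓡 ∧ (A b).ncard = n from ⟨hAfin b, hA𝓡 b, hb⟩,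
        Set.mem_iInter₂.2 fun a _ ↦ ?_⟩
      exact Iff.rfl
    · rintro ⟨t, ht, hiff⟩
      obtain ⟨-, ht𝓡, htn⟩ : t.Finite ∧ t ⊆ 𝓡 ∧ t.ncard = n := ht
      rw [Set.mem_iInter₂] at hiff
      have hAt : A b = t := Set.ext fun a ↦
        ⟨fun ha ↦ (show a ∈ A b ↔ a ∈ t from hiff a (hA𝓡 b ha)).1 ha,
          fun ha ↦ (show a ∈ A b ↔ a ∈ t from hiff a (ht𝓡 ha)).2 ha⟩
      rw [hAt, htn]
  rw [heq]
  refine MeasurableSet.biUnion hD fun t _ ↦ MeasurableSet.biInter h𝓡 fun a _ ↦ ?_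
  exact measurableSet_setOf.2 ((hmeas a).iff measurable_const)

/-- **The number of interface loops of `siteLoopConfig δ` in a measurably parametrised sub-family
of the loops meeting `B̄(0, R)` is a measurable function of the parameter** (`δ > 0`): the loops
are polygons of closed honeycomb walks (a countable family, `loops_siteLoopConfig_subset_range`,
`countable_sigma_hexLoop`), membership is measurable (`measurable_mem_loops_siteLoopConfig`) and
only finitely many loops meet the ball (`ncard_loops_siteLoopConfig_meeting_le`). -/
theorem cr_measurable_ncard_loops {β : Type*} [MeasurableSpace β] {δ : ℝ} (hδ : 0 < δ) (R : ℝ)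
    {Φ : β → SiteConfig (Site 2)} (hΦ : Measurable Φ) {Q : β → UnbasedLoop ℂ → Prop}
    (hQ : ∀ u, Measurable fun b ↦ Q b u)
    (hQR : ∀ b u, Q b u → (u.range ∩ closedBall (0 : ℂ) R).Nonempty) :
    Measurable fun b ↦ Set.ncard {u ∈ (siteLoopConfig δ (Φ b)).loops | Q b u} := by
  haveI := countable_sigma_hexLoop
  refine cr_measurable_ncard (Set.countable_range _)
    (fun b u hu ↦ loops_siteLoopConfig_subset_range δ (Φ b) hu.1)
    (fun b ↦ (ncard_loops_siteLoopConfig_meeting_le hδ R (Φ b)).1.subset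
      fun u hu ↦ ⟨hu.1, hQR b u hu.2⟩)
    fun u ↦ ((measurable_mem_loops_siteLoopConfig δ u).comp hΦ).and (hQ u)

/-! ## §3 The pathwise count representation -/

/-- **Pathwise count representation.**  For an admissible density `f` (measurable, `|f| ≤ C`,
`f = 0` off `B̄(0, R)`, `∫ f = 0`) and a loop family `L` with finitely many loops meeting
`B̄(0, R)`: `Σ_u θ_u² = ∬ f(x) f(y) #{u ∈ L : W(u,x) ≠ 0, W(u,y) ≠ 0, u meets B̄(0,R)}` and
`(Σ_u θ_u)² = ∬ f(x) f(y) N(x) N(y)`, `N(x) = #{u ∈ L : W(u,x) ≠ 0, u meets B̄(0,R)}` — honest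
finite sums over the loops meeting the ball (`sw_meets_of_nestingPhase_ne_zero`),
`θ_u = ∫ f 𝟙_{W(u,·) ≠ 0}`, products of integrals as iterated integrals, and finite sums exchanged
with the integrals. -/
theorem cr_pathwise {f : ℂ → ℝ} {R C : ℝ} (hf : Measurable f) (hC : ∀ z, |f z| ≤ C)
    (hR : ∀ z, R < ‖z‖ → f z = 0) (h0 : ∫ z, f z = 0) {L : Set (UnbasedLoop ℂ)}
    (hT : {u ∈ L | (u.range ∩ closedBall (0 : ℂ) R).Nonempty}.Finite) :
    (∑ᶠ u ∈ L, u.nestingPhase f ^ 2) = ∫ x, ∫ y, f x * f y *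
        (Set.ncard {u ∈ L | u.wind x ≠ 0 ∧ u.wind y ≠ 0 ∧
          (u.range ∩ closedBall (0 : ℂ) R).Nonempty} : ℝ) ∧
    (∑ᶠ u ∈ L, u.nestingPhase f) ^ 2 = ∫ x, ∫ y, f x * f y *
        ((Set.ncard {u ∈ L | u.wind x ≠ 0 ∧ (u.range ∩ closedBall (0 : ℂ) R).Nonempty} : ℝ) *
          (Set.ncard {u ∈ L | u.wind y ≠ 0 ∧
            (u.range ∩ closedBall (0 : ℂ) R).Nonempty} : ℝ)) := by
  classical
  -- the finite family `S` of loops meeting the ball, and the interior indicators `g u`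
  obtain ⟨S, hmemS⟩ : ∃ S : Finset (UnbasedLoop ℂ), ∀ u, u ∈ S ↔
      u ∈ L ∧ (u.range ∩ closedBall (0 : ℂ) R).Nonempty :=
    ⟨hT.toFinset, fun u ↦ by rw [Set.Finite.mem_toFinset, Set.mem_setOf_eq]⟩
  obtain ⟨g, hg⟩ : ∃ g : UnbasedLoop ℂ → ℂ → ℝ, ∀ u, g u = {z | u.wind z ≠ 0}.indicator f :=
    ⟨_, fun _ ↦ rfl⟩
  have hfi : Integrable f volume := integrable_of_abs_le_of_eq_zero hf hC hR
  have hgi : ∀ u, Integrable (g u) volume := fun u ↦ by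
    rw [hg]
    exact hfi.indicator (measurableSet_setOf_wind_ne_zero u)
  have hθ : ∀ u : UnbasedLoop ℂ, u.nestingPhase f = ∫ x, g u x := fun u ↦ by
    rw [hg]
    exact (integral_indicator (measurableSet_setOf_wind_ne_zero u)).symm
  have hg1 : ∀ u x, u.wind x ≠ 0 → g u x = f x := fun u x hx ↦ by
    rw [hg]
    exact Set.indicator_of_mem hx f
  have hg0 : ∀ u x, ¬u.wind x ≠ 0 → g u x = 0 := fun u x hx ↦ by
    rw [hg]
    exact Set.indicator_of_notMem hx f
  -- finsums are finite sums over `S`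
  have hfs : ∀ φ : ℝ → ℝ, φ 0 = 0 →
      ∑ᶠ u ∈ L, φ (u.nestingPhase f) = ∑ u ∈ S, φ (u.nestingPhase f) := by
    intro φ hφ
    refine finsum_mem_eq_sum_of_subset _ (fun u hu ↦ ?_) (fun u hu ↦ ((hmemS u).1 hu).1)
    rw [Finset.mem_coe, hmemS]
    refine ⟨hu.1, sw_meets_of_nestingPhase_ne_zero hR h0 fun h ↦ hu.2 ?_⟩
    show φ (u.nestingPhase f) = 0
    rw [h, hφ]
  -- the counts as finite sums of indicators
  have hC1 : ∀ x, ∑ u ∈ S, g u x = f x *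
      (Set.ncard {u ∈ L | u.wind x ≠ 0 ∧ (u.range ∩ closedBall (0 : ℂ) R).Nonempty} : ℝ) := by
    intro x
    rw [cr_sum_eq_card_mul S (fun u ↦ u.wind x ≠ 0) (fun u ↦ g u x) (f x)
        (fun u _ hu ↦ hg1 u x hu) (fun u _ hu ↦ hg0 u x hu),
      cr_ncard_sep_eq_card_filter hmemS _ (fun u ↦ u.wind x ≠ 0) (fun u ↦ Iff.rfl), mul_comm]
  have hC2 : ∀ x y, ∑ u ∈ S, g u x * g u y = f x * f y *
      (Set.ncard {u ∈ L | u.wind x ≠ 0 ∧ u.wind y ≠ 0 ∧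
        (u.range ∩ closedBall (0 : ℂ) R).Nonempty} : ℝ) := by
    intro x y
    rw [cr_sum_eq_card_mul S (fun u ↦ u.wind x ≠ 0 ∧ u.wind y ≠ 0) (fun u ↦ g u x * g u y)
        (f x * f y) (fun u _ hu ↦ by rw [hg1 u x hu.1, hg1 u y hu.2]) (fun u _ hu ↦ ?_),
      cr_ncard_sep_eq_card_filter hmemS _ (fun u ↦ u.wind x ≠ 0 ∧ u.wind y ≠ 0)
        (fun u ↦ and_assoc.symm), mul_comm]
    rcases not_and_or.1 hu with h | h
    · rw [hg0 u x h, zero_mul]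
    · rw [hg0 u y h, mul_zero]
  refine ⟨?_, ?_⟩
  · -- `Σ_u θ_u²`
    rw [hfs (fun t ↦ t ^ 2) (by norm_num)]
    calc ∑ u ∈ S, u.nestingPhase f ^ 2
        = ∑ u ∈ S, ∫ x, g u x * u.nestingPhase f :=
          Finset.sum_congr rfl fun u _ ↦ by rw [integral_mul_const, ← hθ u, sq]
      _ = ∫ x, ∑ u ∈ S, g u x * u.nestingPhase f :=
          (integral_finsetSum S fun u _ ↦ (hgi u).mul_const _).symm
      _ = ∫ x, ∑ u ∈ S, ∫ y, g u x * g u y := by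
          refine integral_congr_ae ?_
          filter_upwards with x
          exact Finset.sum_congr rfl fun u _ ↦ by rw [integral_const_mul, ← hθ u]
      _ = ∫ x, ∫ y, ∑ u ∈ S, g u x * g u y := by
          refine integral_congr_ae ?_
          filter_upwards with x
          exact (integral_finsetSum S fun u _ ↦ (hgi u).const_mul _).symm
      _ = _ := by
          refine integral_congr_ae ?_
          filter_upwards with x
          refine integral_congr_ae ?_
          filter_upwards with y
          exact hC2 x y
  · -- `(Σ_u θ_u)²`
    rw [hfs (fun t ↦ t) rfl]
    have hA1 : ∑ u ∈ S, u.nestingPhase f = ∫ x, ∑ u ∈ S, g u x := by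
      rw [integral_finsetSum S fun u _ ↦ hgi u]
      exact Finset.sum_congr rfl fun u _ ↦ hθ u
    calc (∑ u ∈ S, u.nestingPhase f) ^ 2
        = (∫ x, ∑ u ∈ S, g u x) * ∫ y, ∑ u ∈ S, g u y := by rw [hA1, sq]
      _ = ∫ x, (∑ u ∈ S, g u x) * ∫ y, ∑ u ∈ S, g u y := (integral_mul_const _ _).symm
      _ = ∫ x, ∫ y, (∑ u ∈ S, g u x) * ∑ u ∈ S, g u y := by
          refine integral_congr_ae ?_
          filter_upwards with x
          exact (integral_const_mul _ _).symm
      _ = _ := by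
          refine integral_congr_ae ?_
          filter_upwards with x
          refine integral_congr_ae ?_
          filter_upwards with y
          rw [hC1 x, hC1 y]
          ring

/-! ## §4 Fubini: the expectation past the two spatial integrals -/

/-- **Fubini for a bounded, jointly measurable loop kernel.**  For a finite measure `P`, an
integrable measurable `f` and a jointly measurable kernel `K ω x y` with `|K| ≤ B`:
`E[∬ f(x) f(y) K(·, x, y)] = ∬ f(x) f(y) E[K(·, x, y)]` (two applications of
`MeasureTheory.integral_integral_swap`; the integrands are dominated by `B |f(x)| |f(y)|`). -/
theorem cr_integral_integral_integral_swap {Ω : Type*} [MeasurableSpace Ω] (P : Measure Ω)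
    [IsFiniteMeasure P] {f : ℂ → ℝ} (hfi : Integrable f volume) (hfm : Measurable f)
    {K : Ω → ℂ → ℂ → ℝ} {B : ℝ} (hKB : ∀ ω x y, |K ω x y| ≤ B)
    (hKm : Measurable fun r : (Ω × ℂ) × ℂ ↦ K r.1.1 r.1.2 r.2) :
    ∫ ω, (∫ x, ∫ y, f x * f y * K ω x y) ∂P = ∫ x, ∫ y, f x * f y * ∫ ω, K ω x y ∂P := by
  have hFm : Measurable fun r : (Ω × ℂ) × ℂ ↦ f r.1.2 * f r.2 * K r.1.1 r.1.2 r.2 :=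
    ((hfm.comp measurable_fst.snd).mul (hfm.comp measurable_snd)).mul hKm
  have hpt : ∀ ω x y, ‖f x * f y * K ω x y‖ ≤ |f x| * B * |f y| := fun ω x y ↦ by
    rw [Real.norm_eq_abs, abs_mul, abs_mul]
    calc |f x| * |f y| * |K ω x y| ≤ |f x| * |f y| * B :=
          mul_le_mul_of_nonneg_left (hKB ω x y) (by positivity)
      _ = |f x| * B * |f y| := by ring
  -- integrability on `Ω × ℂ` of `(ω, y) ↦ f x f y K` for every `x`
  have hI2 : ∀ x, Integrable (Function.uncurry fun ω y ↦ f x * f y * K ω x y)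
      (P.prod volume) := by
    intro x
    have hm : Measurable fun q : Ω × ℂ ↦ f x * f q.2 * K q.1 x q.2 :=
      hFm.comp ((measurable_fst.prodMk measurable_const).prodMk measurable_snd)
    refine Integrable.mono' ((integrable_const (|f x| * B)).mul_prod hfi.abs)
      hm.aestronglyMeasurable (Eventually.of_forall fun q ↦ ?_)
    exact hpt q.1 x q.2
  -- integrability on `Ω × ℂ` of `(ω, x) ↦ ∫ f x f y K dy`
  have hI1 : Integrable (Function.uncurry fun ω x ↦ ∫ y, f x * f y * K ω x y)
      (P.prod volume) := by
    have hsm : StronglyMeasurable fun p : Ω × ℂ ↦ ∫ y, f p.2 * f y * K p.1 p.2 y :=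
      hFm.stronglyMeasurable.integral_prod_right'
    refine Integrable.mono' ((integrable_const (B * ∫ y, |f y|)).mul_prod hfi.abs)
      hsm.aestronglyMeasurable (Eventually.of_forall fun p ↦ ?_)
    calc ‖∫ y, f p.2 * f y * K p.1 p.2 y‖ ≤ ∫ y, |f p.2| * B * |f y| :=
          norm_integral_le_of_norm_le (hfi.abs.const_mul (|f p.2| * B))
            (Eventually.of_forall fun y ↦ hpt p.1 p.2 y)
      _ = B * (∫ y, |f y|) * |f p.2| := by rw [integral_const_mul]; ring
  calc ∫ ω, (∫ x, ∫ y, f x * f y * K ω x y) ∂P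
      = ∫ x, ∫ ω, (∫ y, f x * f y * K ω x y) ∂P := integral_integral_swap hI1
    _ = ∫ x, ∫ y, ∫ ω, f x * f y * K ω x y ∂P := by
        refine integral_congr_ae ?_
        filter_upwards with x
        exact integral_integral_swap (hI2 x)
    _ = ∫ x, ∫ y, f x * f y * ∫ ω, K ω x y ∂P := by
        refine integral_congr_ae ?_
        filter_upwards with x
        refine integral_congr_ae ?_
        filter_upwards with y
        exact integral_const_mul _ _

/-! ## The registered sub-goal -/

/-- **Sub-goal CR (`cr_expect_powerSums_eq_counts`) · count representation of the two-point
power-sum statistics at fixed mesh.**  For an admissible density `f` (measurable, `|f| ≤ C`,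
`f = 0` off `B̄(0, R)`, `∫ f = 0`) and a mesh `δ > 0`, with `θ_u = ∫_{W(u,·) ≠ 0} f` over the
interface loops of `siteLoopConfig δ ω` under `triSitePercolation half`,
`N(x) = #{u : W(u,x) ≠ 0, u meets B̄(0,R)}` and
`N(x ∧ y) = #{u : W(u,x) ≠ 0, W(u,y) ≠ 0, u meets B̄(0,R)}`:
`E[Σ_u θ_u²] = ∬ f(x) f(y) E[N(x ∧ y)]` and `E[(Σ_u θ_u)²] = ∬ f(x) f(y) E[N(x) N(y)]`.
Pathwise (`cr_pathwise`): only the finitely many loops meeting `B̄(0, R)` contribute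
(`sw_meets_of_nestingPhase_ne_zero`, `ncard_loops_siteLoopConfig_meeting_le`),
`θ_u = ∫ f 𝟙_{int u}`, so `Σ_u θ_u² = ∬ f f N_ω(x ∧ y)` and `(Σ_u θ_u)² = ∬ f f N_ω(x) N_ω(y)`;
then Fubini (`cr_integral_integral_integral_swap`): the counts are bounded by the deterministic
number of faces near the ball and jointly measurable (`cr_measurable_ncard_loops`: finite
sub-families of the countable family of lattice polygons with measurable membership). -/
theorem cr_expect_powerSums_eq_counts : ∀ (f : ℂ → ℝ) (R C : ℝ), Measurable f → (∀ z, |f z| ≤ C) →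
    (∀ z, R < ‖z‖ → f z = 0) → ∫ z, f z = 0 → ∀ δ : ℝ, 0 < δ →
    (∫ ω, (∑ᶠ u ∈ (siteLoopConfig δ ω).loops, u.nestingPhase f ^ 2) ∂(triSitePercolation half) =
      ∫ x, ∫ y, f x * f y * ∫ ω, (Set.ncard {u ∈ (siteLoopConfig δ ω).loops | u.wind x ≠ 0 ∧ u.wind y ≠ 0 ∧
        (u.range ∩ Metric.closedBall (0 : ℂ) R).Nonempty} : ℝ) ∂(triSitePercolation half)) ∧
    (∫ ω, (∑ᶠ u ∈ (siteLoopConfig δ ω).loops, u.nestingPhase f) ^ 2 ∂(triSitePercolation half) =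
      ∫ x, ∫ y, f x * f y * ∫ ω, ((Set.ncard {u ∈ (siteLoopConfig δ ω).loops | u.wind x ≠ 0 ∧
        (u.range ∩ Metric.closedBall (0 : ℂ) R).Nonempty} : ℝ) *
        (Set.ncard {u ∈ (siteLoopConfig δ ω).loops | u.wind y ≠ 0 ∧
        (u.range ∩ Metric.closedBall (0 : ℂ) R).Nonempty} : ℝ)) ∂(triSitePercolation half)) := by
  intro f R C hf hC hR h0 δ hδ
  have hfi : Integrable f volume := integrable_of_abs_le_of_eq_zero hf hC hR
  -- finiteness and the deterministic bound on the loops meeting the ball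
  have hT : ∀ ω : SiteConfig (Site 2),
      {u ∈ (siteLoopConfig δ ω).loops | (u.range ∩ closedBall (0 : ℂ) R).Nonempty}.Finite :=
    fun ω ↦ (ncard_loops_siteLoopConfig_meeting_le hδ R ω).1
  set Nmax : ℕ := (finite_setOf_norm_hexCenter_le hδ (R + 2 * δ)).toFinset.card with hNmax
  have hN₂le : ∀ (ω : SiteConfig (Site 2)) (x y : ℂ),
      |((Set.ncard {u ∈ (siteLoopConfig δ ω).loops | u.wind x ≠ 0 ∧ u.wind y ≠ 0 ∧
        (u.range ∩ closedBall (0 : ℂ) R).Nonempty} : ℝ))| ≤ Nmax := fun ω x y ↦ by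
    rw [Nat.abs_cast, Nat.cast_le]
    refine (Set.ncard_le_ncard (fun u hu ↦ ?_) (hT ω)).trans
      (ncard_loops_siteLoopConfig_meeting_le hδ R ω).2
    exact ⟨hu.1, hu.2.2.2⟩
  have hN₁le : ∀ (ω : SiteConfig (Site 2)) (x : ℂ),
      ((Set.ncard {u ∈ (siteLoopConfig δ ω).loops | u.wind x ≠ 0 ∧
        (u.range ∩ closedBall (0 : ℂ) R).Nonempty} : ℝ)) ≤ Nmax := fun ω x ↦ by
    rw [Nat.cast_le]
    refine (Set.ncard_le_ncard (fun u hu ↦ ?_) (hT ω)).trans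
      (ncard_loops_siteLoopConfig_meeting_le hδ R ω).2
    exact ⟨hu.1, hu.2.2⟩
  have hN₁₁le : ∀ (ω : SiteConfig (Site 2)) (x y : ℂ),
      |((Set.ncard {u ∈ (siteLoopConfig δ ω).loops | u.wind x ≠ 0 ∧
        (u.range ∩ closedBall (0 : ℂ) R).Nonempty} : ℝ)) *
        ((Set.ncard {u ∈ (siteLoopConfig δ ω).loops | u.wind y ≠ 0 ∧
        (u.range ∩ closedBall (0 : ℂ) R).Nonempty} : ℝ))| ≤ Nmax * Nmax := fun ω x y ↦ by
    rw [abs_mul, Nat.abs_cast, Nat.abs_cast]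
    exact mul_le_mul (hN₁le ω x) (hN₁le ω y) (Nat.cast_nonneg _) (Nat.cast_nonneg _)
  -- joint measurability of the counts
  have hwm : ∀ u : UnbasedLoop ℂ, Measurable fun z ↦ u.wind z ≠ 0 := fun u ↦
    measurableSet_setOf.1 (measurableSet_setOf_wind_ne_zero u)
  have hcast : Measurable fun n : ℕ ↦ (n : ℝ) := measurable_from_nat
  have hmN₂ : Measurable fun r : (SiteConfig (Site 2) × ℂ) × ℂ ↦
      ((Set.ncard {u ∈ (siteLoopConfig δ r.1.1).loops | u.wind r.1.2 ≠ 0 ∧ u.wind r.2 ≠ 0 ∧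
        (u.range ∩ closedBall (0 : ℂ) R).Nonempty} : ℝ)) :=
    hcast.comp (cr_measurable_ncard_loops hδ R measurable_fst.fst
      (Q := fun r u ↦ u.wind r.1.2 ≠ 0 ∧ u.wind r.2 ≠ 0 ∧
        (u.range ∩ closedBall (0 : ℂ) R).Nonempty)
      (fun u ↦ ((hwm u).comp measurable_fst.snd).and (((hwm u).comp measurable_snd).and
        measurable_const))
      fun _ _ hu ↦ hu.2.2)
  have hmA : Measurable fun r : (SiteConfig (Site 2) × ℂ) × ℂ ↦
      ((Set.ncard {u ∈ (siteLoopConfig δ r.1.1).loops | u.wind r.1.2 ≠ 0 ∧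
        (u.range ∩ closedBall (0 : ℂ) R).Nonempty} : ℝ)) :=
    hcast.comp (cr_measurable_ncard_loops hδ R measurable_fst.fst
      (Q := fun r u ↦ u.wind r.1.2 ≠ 0 ∧ (u.range ∩ closedBall (0 : ℂ) R).Nonempty)
      (fun u ↦ ((hwm u).comp measurable_fst.snd).and measurable_const)
      fun _ _ hu ↦ hu.2)
  have hmB : Measurable fun r : (SiteConfig (Site 2) × ℂ) × ℂ ↦
      ((Set.ncard {u ∈ (siteLoopConfig δ r.1.1).loops | u.wind r.2 ≠ 0 ∧
        (u.range ∩ closedBall (0 : ℂ) R).Nonempty} : ℝ)) :=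
    hcast.comp (cr_measurable_ncard_loops hδ R measurable_fst.fst
      (Q := fun r u ↦ u.wind r.2 ≠ 0 ∧ (u.range ∩ closedBall (0 : ℂ) R).Nonempty)
      (fun u ↦ ((hwm u).comp measurable_snd).and measurable_const)
      fun _ _ hu ↦ hu.2)
  have hmN₁₁ : Measurable fun r : (SiteConfig (Site 2) × ℂ) × ℂ ↦
      ((Set.ncard {u ∈ (siteLoopConfig δ r.1.1).loops | u.wind r.1.2 ≠ 0 ∧
        (u.range ∩ closedBall (0 : ℂ) R).Nonempty} : ℝ)) *
        ((Set.ncard {u ∈ (siteLoopConfig δ r.1.1).loops | u.wind r.2 ≠ 0 ∧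
        (u.range ∩ closedBall (0 : ℂ) R).Nonempty} : ℝ)) :=
    hmA.mul hmB
  refine ⟨?_, ?_⟩
  · calc ∫ ω, (∑ᶠ u ∈ (siteLoopConfig δ ω).loops, u.nestingPhase f ^ 2)
          ∂(triSitePercolation half)
        = ∫ ω, (∫ x, ∫ y, f x * f y * (Set.ncard {u ∈ (siteLoopConfig δ ω).loops |
            u.wind x ≠ 0 ∧ u.wind y ≠ 0 ∧ (u.range ∩ closedBall (0 : ℂ) R).Nonempty} : ℝ))
            ∂(triSitePercolation half) :=
          integral_congr_ae (Eventually.of_forall fun ω ↦ (cr_pathwise hf hC hR h0 (hT ω)).1)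
      _ = _ := cr_integral_integral_integral_swap (triSitePercolation half) hfi hf hN₂le hmN₂
  · calc ∫ ω, (∑ᶠ u ∈ (siteLoopConfig δ ω).loops, u.nestingPhase f) ^ 2
          ∂(triSitePercolation half)
        = ∫ ω, (∫ x, ∫ y, f x * f y *
            ((Set.ncard {u ∈ (siteLoopConfig δ ω).loops | u.wind x ≠ 0 ∧
              (u.range ∩ closedBall (0 : ℂ) R).Nonempty} : ℝ) *
            (Set.ncard {u ∈ (siteLoopConfig δ ω).loops | u.wind y ≠ 0 ∧
              (u.range ∩ closedBall (0 : ℂ) R).Nonempty} : ℝ))) ∂(triSitePercolation half) :=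
          integral_congr_ae (Eventually.of_forall fun ω ↦ (cr_pathwise hf hC hR h0 (hT ω)).2)
      _ = _ := cr_integral_integral_integral_swap (triSitePercolation half) hfi hf hN₁₁le hmN₁₁

end Summit.CriticalPhenomena.CardyFormulaZ2.Cruxes.MagicFormulaT.LineSketch

end
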